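import Mathlib
import HarnessLib
import Literature.MathematicalPhysics.StatisticalMechanics.StepOperatorBABKMQ
import Literature.MathematicalPhysics.StatisticalMechanics.NextHamiltonianBounds

/-!
# Lipschitz dependence of `B_k^{(q)} = −Π₂ R^{(q)}_{k+1}(·)(B₀)` on the step kernel
# ([ABKM19] Lemma 12.6, hypothesis (12.52) for `B_k`; Lemma 10.6 ⊗ Lemma 8.4 (`ℓ = 1`))

The fine tuning of [ABKM19] Ch. 12 (Lemma 12.6, here in the Brouwer form
`RGFlow.exists_isTunedQ_initial_eq_of_finiteDimensional`, hypothesis `hb`) needs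
`‖B_k^{(q)} K − B_k^{(q')} K‖_{k+1,0} ≤ b · |q − q'| · ‖K‖_k^{(A)}` with ANY finite `b`.  Since
`B_k^{(q)} K − B_k^{(q')} K = −Π₂ (R_{𝒞a} − R_{𝒞b}) K(B₀)`, Lemma 8.7 (`hamNorm_Pi2_le`) reduces this
to the Taylor norm at `φ = 0` of the DIFFERENCE of the two fluctuation integrals of `K(B₀)`, which
is the `ℓ = 1` integration property (`FluctuationKernelComparison.tayNormLE_fluct_sub_fluct`, here
taken as the hypothesis `hdiff` in the shape of `IntegrationProperty` with constant `ℓ κ^{|X|_k}`):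

* **`hamNorm_opB_sub_le`** — at the scale-`k` weights:
  `‖B_{𝒞a} K − B_{𝒞b} K‖_{𝔥_k, R_k, |B₀|} ≤ C_{8.7} · C ℓ κ A^{−1}` for `‖K‖_k^{(A)} ≤ C`;
* **`hamNorm_opB_sub_le_succ`** — at the scale-`(k+1)` weights (cost `L^d`);
* **`hamNorm_opB_sub_abkm_le_of_stepKernelBounds`** — for the torus parameters `abkmNormParams`
  and two step data with kernels by predicate (`StepKernelBounds`) sharing `B₀, c₀`.

Everything is proved; no named fact.

## References
* S. Adams, S. Buchholz, R. Kotecký, S. Müller, arXiv:1910.13564, Lemma 12.6 (12.52), Lemma 10.6,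
  Lemma 8.7, Lemma 8.4 [AdamsBuchholzKoteckyMuller2019].
-/

noncomputable section

namespace Literature.MathematicalPhysics.StatisticalMechanics.GradientRG

open scoped BigOperators Classical
open Finset
open Literature.MathematicalPhysics.StatisticalMechanics.TorusPolymer
  (IsPolymer blocks numBlocks blockOf thicken mem_blockOf_self isPolymer_blockOf blocks_blockOf
    card_blocks_eq_numBlocks boxCorner subset_thicken card_blockOf)
open Literature.Barriers.CriticalPhenomena.LongRangePhi4.Polymer (IsConn)
open Literature.MathematicalPhysics.QuantumFieldTheory

variable {d M : ℕ} [NeZero M]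

/-! ## The abstract estimate (Lemma 8.7 at `φ = 0` for the difference) -/

/-- **`‖B_{𝒞a} K − B_{𝒞b} K‖_{𝔥_k,R_k,|B₀|} ≤ C_{8.7} · C ℓ κ A^{−1}`** for `‖K‖_k^{(A)} ≤ C`, given the
`ℓ = 1` integration property `hdiff` (`‖R_{𝒞a}F − R_{𝒞b}F‖_{k:k+1,X} ≤ ℓ κ^{|X|_k} ‖F‖_{k,X}` for
connected `k`-polymers), `K` local and `C^{r₀}` with `C^{r₀}` fluctuation integrals under both
kernels, and two step data sharing the reference block `B₀` (a `k`-block with its box `B₀*`).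
[cite: AdamsBuchholzKoteckyMuller2019, Lemma 12.6 (12.52) / Lemma 10.6] -/
theorem hamNorm_opB_sub_le (P : NormParams d M) {k t : ℕ} (hM : M = P.L ^ k * t) (hL : Odd P.L)
    (ht : Odd t) (Da Db : StepData d M) {x₀ : Fin d → ZMod M} (hB₀ : Da.B₀ = blockOf (P.L ^ k) x₀)
    (hc₀ : Da.c₀ = boxCorner (P.L ^ k) (P.rad k) x₀) (hB₀' : Db.B₀ = Da.B₀) (hc₀' : Db.c₀ = Da.c₀)
    (h𝔥 : 0 < P.𝔥 k) (hR : 0 < P.R k)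
    (hr₀ : 2 ≤ P.r₀) (hwrap : 4 * ((P.L ^ k - 1) / 2 + P.rad k) < M)
    (hroom : ((2 * ((P.L ^ k - 1) / 2 + P.rad k) : ℕ) + (P.p : ℤ)) * 2 < M)
    {C₀ : ℝ} (hC₀ : 1 ≤ C₀)
    (hρ0 : ((2 * ((P.L ^ k - 1) / 2 + P.rad k) : ℕ) : ℝ) + (d / 2 + 1 : ℕ) ≤ C₀ * P.R k)
    {ℓ κ : ℝ}
    (hdiff : ∀ X : Finset (Fin d → ZMod M), IsPolymer (P.L ^ k) X → IsConn X →
      ∀ (F : ((Fin d → ZMod M) → ℝ) → ℂ) (C : ℝ), 0 ≤ C → ContDiff ℝ P.r₀ F →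
        IsGaugeLocal (P.gauge k X) F → TayNormLE (P.gauge k X) P.r₀ (P.W.weight k X) F C →
          TayNormLE (P.gauge k X) P.r₀ (P.W.midWeight k X) (fluct Da.𝒞 F - fluct Db.𝒞 F)
            (C * ℓ * κ ^ numBlocks (P.L ^ k) X))
    {K : Finset (Fin d → ZMod M) → ((Fin d → ZMod M) → ℝ) → ℂ} {C : ℝ} (hC : 0 ≤ C)
    (hK : WeakNormLE P k K C) (hKd : ∀ X, ContDiff ℝ P.r₀ (K X))
    (hKloc : ∀ X, IsPolymer (P.L ^ k) X → IsConn X → IsGaugeLocal (P.gauge k X) (K X))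
    (hRa : ∀ X, ContDiff ℝ P.r₀ (fluct Da.𝒞 (K X))) (hRb : ∀ X, ContDiff ℝ P.r₀ (fluct Db.𝒞 (K X)))
    (hA : 1 ≤ P.A) :
    hamNorm (P.𝔥 k) (P.R k) Da.B₀.card (opB Da K - opB Db K) ≤
      pi2BoundConst d C₀ * (C * ℓ * κ * P.A⁻¹) := by
  set s := P.L ^ k with hsdef
  have hsodd : Odd s := hL.pow
  have hMo : Odd M := by rw [hM]; exact hsodd.mul ht
  have hA0 : 0 < P.A := by linarith
  have hr2 : (2 : WithTop ℕ∞) ≤ P.r₀ := by exact_mod_cast hr₀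
  -- `B_a K − B_b K = −Π₂ (R_a − R_b) K(B₀)`
  have hsub : opB Da K - opB Db K = -Pi2 Da.c₀ Da.B₀ (fluct Da.𝒞 (K Da.B₀) - fluct Db.𝒞 (K Da.B₀)) := by
    unfold opB
    rw [hB₀', hc₀', Pi2_sub_of_contDiff _ _ ((hRa _).of_le hr2) ((hRb _).of_le hr2)]
    abel
  rw [hsub, hamNorm_neg, hB₀]
  -- the box `B₀*`
  set B := blockOf s x₀ with hBdef
  set S := thicken (P.rad k) B with hSdef
  set ρ' : ℕ := 2 * ((s - 1) / 2 + P.rad k) with hρ'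
  have hS : ∀ x, x ∈ S ↔ InBox Da.c₀ ρ' x := fun x => by
    rw [hc₀]; exact TorusPolymer.mem_thicken_blockOf_iff_inBox hM hsodd ht hwrap x₀ x
  have hroomS : ∀ x ∈ S, HasRoom Da.c₀ x P.p := fun x hx =>
    TorusPolymer.hasRoom_of_inBox ((hS x).1 hx) hroom
  have hSρ : ∀ x ∈ S, ∀ i, |relCoord Da.c₀ x i| ≤ ρ' := fun x hx i => by
    obtain ⟨h1, h2⟩ := (hS x).1 hx i
    rw [abs_of_nonneg h1]; exact h2
  have hBS : B ⊆ S := subset_thicken _ _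
  have hBne : B.card ≠ 0 := (card_pos.2 ⟨x₀, mem_blockOf_self s x₀⟩).ne'
  -- `F = (R_a − R_b) K(B₀)` is local, `C^{r₀}`, and `|F|_{T_0} ≤ C ℓ κ A^{-1}`
  have hPB : IsPolymer (P.L ^ k) B := isPolymer_blockOf _ x₀
  have hcB : IsConn B := TorusPolymer.isConn_blockOf hMo hsodd x₀
  have hgauge : P.gauge k B = fieldGauge (P.𝔥 k) (P.R k) P.p S := rfl
  have hlocK : IsGaugeLocal (fieldGauge (P.𝔥 k) (P.R k) P.p S) (K B) := hKloc _ hPB hcB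
  have hlocFa : IsGaugeLocal (fieldGauge (P.𝔥 k) (P.R k) P.p S) (fluct Da.𝒞 (K B)) :=
    isGaugeLocal_integral _ (stepMeasure Da.𝒞) fun ξ => hlocK.comp_add_right _ ξ
  have hlocFb : IsGaugeLocal (fieldGauge (P.𝔥 k) (P.R k) P.p S) (fluct Db.𝒞 (K B)) :=
    isGaugeLocal_integral _ (stepMeasure Db.𝒞) fun ξ => hlocK.comp_add_right _ ξ
  have hlocF : IsGaugeLocal (fieldGauge (P.𝔥 k) (P.R k) P.p S)
      (fluct Da.𝒞 (K B) - fluct Db.𝒞 (K B)) := fun φ ψ hφψ => by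
    simp only [Pi.sub_apply]
    rw [hlocFa φ ψ hφψ, hlocFb φ ψ hφψ]
  have hFd : ContDiff ℝ P.r₀ (fluct Da.𝒞 (K B) - fluct Db.𝒞 (K B)) := (hRa B).sub (hRb B)
  have hnB : numBlocks (P.L ^ k) B = 1 := by
    rw [← card_blocks_eq_numBlocks, blocks_blockOf, card_singleton]
  have hF0 : tayNorm (fieldGauge (P.𝔥 k) (P.R k) P.p S) P.r₀
      (fluct Da.𝒞 (K B) - fluct Db.𝒞 (K B)) 0 ≤ C * ℓ * κ * P.A⁻¹ := by
    have h1 := hdiff _ hPB hcB (K B) (C * P.aFactor k B)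
      (mul_nonneg hC (WeakNormLE.aFactor_pos hA0 k _).le) (hKd _) (hgauge ▸ hlocK) (hK _ hPB hcB) 0
    rw [hnB, pow_one, NormParams.aFactor, hnB, pow_one, WeightData.midWeight_zero, mul_one] at h1
    calc _ ≤ C * (P.A)⁻¹ * ℓ * κ := h1
      _ = C * ℓ * κ * P.A⁻¹ := by ring
  -- Lemma 8.7
  have h87 := hamNorm_Pi2_le (c := Da.c₀) hBne hBS hroomS hSρ h𝔥 hR hC₀ hρ0 hr₀ hFd hlocF
  exact h87.trans (mul_le_mul_of_nonneg_left hF0 (pi2BoundConst_nonneg d (by linarith)))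

/-- **Lipschitz dependence of `B_k` on the step kernel at the scale-`(k+1)` weights**:
`‖B_{𝒞a} K − B_{𝒞b} K‖_{k+1,0} ≤ L^d C_{8.7} · C ℓ κ A^{−1}` (`𝔥_{k+1} ≤ 𝔥_k`, `R_k ≤ R_{k+1}`,
`|B'| = L^d |B₀|`). [cite: AdamsBuchholzKoteckyMuller2019, Lemma 12.6 (12.52) / Lemma 10.6] -/
theorem hamNorm_opB_sub_le_succ (P : NormParams d M) {k t : ℕ} (hM : M = P.L ^ k * t) (hL : Odd P.L)
    (ht : Odd t) (Da Db : StepData d M) {x₀ : Fin d → ZMod M} (hB₀ : Da.B₀ = blockOf (P.L ^ k) x₀)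
    (hc₀ : Da.c₀ = boxCorner (P.L ^ k) (P.rad k) x₀) (hB₀' : Db.B₀ = Da.B₀) (hc₀' : Db.c₀ = Da.c₀)
    (h𝔥' : 0 < P.𝔥 (k + 1))
    (h𝔥le : P.𝔥 (k + 1) ≤ P.𝔥 k) (hR : 0 < P.R k) (hRle : P.R k ≤ P.R (k + 1))
    (hr₀ : 2 ≤ P.r₀) (hwrap : 4 * ((P.L ^ k - 1) / 2 + P.rad k) < M)
    (hroom : ((2 * ((P.L ^ k - 1) / 2 + P.rad k) : ℕ) + (P.p : ℤ)) * 2 < M)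
    {C₀ : ℝ} (hC₀ : 1 ≤ C₀)
    (hρ0 : ((2 * ((P.L ^ k - 1) / 2 + P.rad k) : ℕ) : ℝ) + (d / 2 + 1 : ℕ) ≤ C₀ * P.R k)
    {ℓ κ : ℝ}
    (hdiff : ∀ X : Finset (Fin d → ZMod M), IsPolymer (P.L ^ k) X → IsConn X →
      ∀ (F : ((Fin d → ZMod M) → ℝ) → ℂ) (C : ℝ), 0 ≤ C → ContDiff ℝ P.r₀ F →
        IsGaugeLocal (P.gauge k X) F → TayNormLE (P.gauge k X) P.r₀ (P.W.weight k X) F C →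
          TayNormLE (P.gauge k X) P.r₀ (P.W.midWeight k X) (fluct Da.𝒞 F - fluct Db.𝒞 F)
            (C * ℓ * κ ^ numBlocks (P.L ^ k) X))
    {K : Finset (Fin d → ZMod M) → ((Fin d → ZMod M) → ℝ) → ℂ} {C : ℝ} (hC : 0 ≤ C)
    (hK : WeakNormLE P k K C) (hKd : ∀ X, ContDiff ℝ P.r₀ (K X))
    (hKloc : ∀ X, IsPolymer (P.L ^ k) X → IsConn X → IsGaugeLocal (P.gauge k X) (K X))
    (hRa : ∀ X, ContDiff ℝ P.r₀ (fluct Da.𝒞 (K X))) (hRb : ∀ X, ContDiff ℝ P.r₀ (fluct Db.𝒞 (K X)))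
    (hA : 1 ≤ P.A) :
    hamNorm (P.𝔥 (k + 1)) (P.R (k + 1)) (P.L ^ d * Da.B₀.card) (opB Da K - opB Db K) ≤
      (P.L : ℝ) ^ d * (pi2BoundConst d C₀ * (C * ℓ * κ * P.A⁻¹)) := by
  have h1 := hamNorm_opB_sub_le P hM hL ht Da Db hB₀ hc₀ hB₀' hc₀' (h𝔥'.trans_le h𝔥le) hR hr₀ hwrap hroom
    hC₀ hρ0 hdiff hC hK hKd hKloc hRa hRb hA
  have h2 := hamNorm_succ_le (n := Da.B₀.card) (Ld := P.L ^ d) h𝔥'.le h𝔥le hR hRle (opB Da K - opB Db K)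
  push_cast at h2
  exact h2.trans (mul_le_mul_of_nonneg_left h1 (by positivity))

/-! ## The torus parameters, kernels by predicate -/

/-- **Lipschitz dependence of `B_k^{(q)}` on the step kernel for the torus data**: for `d ≥ 3`, `L` odd,
`L ≥ 2^{d+3} + 16R`, `M = L^N`, `k + 1 ≤ N`, the weight tower of Theorem 7.1, two step data of scale
`k` sharing the reference block and its box, whose kernels satisfy `StepKernelBounds`, the `ℓ = 1`
integration property `hdiff` for the pair of kernels (e.g. from
`FluctuationKernelComparisonABKM.tayNormLE_fluct_sub_fluct_abkm`), and a local `C^{r₀}` activity with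
`‖K‖_k^{(A)} ≤ C`: `‖B_{𝒞a} K − B_{𝒞b} K‖_{k+1,0} ≤ L^d · C_{8.7} · C ℓ κ A^{−1}`.
[cite: AdamsBuchholzKoteckyMuller2019, Lemma 12.6 (12.52)] -/
theorem hamNorm_opB_sub_abkm_le_of_stepKernelBounds {L N Mord R n p r₀ : ℕ}
    {θbar lam μ δ₁ δ₀ A𝒫 A𝒫a A𝒫b C₂a C₂b h A : ℝ}
    {𝒞 : ℕ → (Fin d → ZMod M) → ℝ} (hd : 3 ≤ d) (hLodd : Odd L) (hL : 2 ^ (d + 3) + 16 * R ≤ L)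
    (hM : M = L ^ N) {k : ℕ} (hkN : k + 1 ≤ N) (hpM : p + d ≤ Mord) (hMR : Mord ≤ R)
    (hr₀ : 3 ≤ r₀)
    (hB : AbkmWeightBounds L N Mord R n θbar lam μ δ₁ δ₀ A𝒫 𝒞
      (abkmWeightData L N Mord R θbar (schedDelta δ₀ δ₁ N) 𝒞))
    (hh : 0 < h) (hA : 1 ≤ A)
    (Da Db : StepData d M)
    (hSa : StepKernelBounds (abkmWeightData L N Mord R θbar (schedDelta δ₀ δ₁ N) 𝒞) L k A𝒫a C₂a Da.𝒞)
    (hSb : StepKernelBounds (abkmWeightData L N Mord R θbar (schedDelta δ₀ δ₁ N) 𝒞) L k A𝒫b C₂b Db.𝒞)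
    {x₀ : Fin d → ZMod M} (hB₀ : Da.B₀ = blockOf (L ^ k) x₀)
    (hc₀ : Da.c₀ = boxCorner (L ^ k) (starRad R L d k) x₀) (hB₀' : Db.B₀ = Da.B₀) (hc₀' : Db.c₀ = Da.c₀)
    {ℓ κ : ℝ}
    (hdiff : ∀ X : Finset (Fin d → ZMod M), IsPolymer (L ^ k) X → IsConn X →
      ∀ (F : ((Fin d → ZMod M) → ℝ) → ℂ) (C : ℝ), 0 ≤ C → ContDiff ℝ r₀ F →
        IsGaugeLocal ((abkmNormParams L N Mord R p r₀ h θbar A (schedDelta δ₀ δ₁ N) 𝒞).gauge k X) F →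
        TayNormLE ((abkmNormParams L N Mord R p r₀ h θbar A (schedDelta δ₀ δ₁ N) 𝒞).gauge k X) r₀
          ((abkmWeightData L N Mord R θbar (schedDelta δ₀ δ₁ N) 𝒞).weight k X) F C →
          TayNormLE ((abkmNormParams L N Mord R p r₀ h θbar A (schedDelta δ₀ δ₁ N) 𝒞).gauge k X) r₀
            ((abkmWeightData L N Mord R θbar (schedDelta δ₀ δ₁ N) 𝒞).midWeight k X)
            (fluct Da.𝒞 F - fluct Db.𝒞 F) (C * ℓ * κ ^ numBlocks (L ^ k) X))
    {K : Finset (Fin d → ZMod M) → ((Fin d → ZMod M) → ℝ) → ℂ} {C : ℝ} (hC : 0 ≤ C)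
    (hK : WeakNormLE (abkmNormParams L N Mord R p r₀ h θbar A (schedDelta δ₀ δ₁ N) 𝒞) k K C)
    (hKd : ∀ X, ContDiff ℝ r₀ (K X))
    (hKloc : ∀ X, IsPolymer (L ^ k) X → IsConn X →
      IsGaugeLocal ((abkmNormParams L N Mord R p r₀ h θbar A (schedDelta δ₀ δ₁ N) 𝒞).gauge k X) (K X)) :
    hamNorm (fieldWt h L d (k + 1)) ((L : ℝ) ^ (k + 1)) (L ^ (d * (k + 1))) (opB Da K - opB Db K) ≤
      (L : ℝ) ^ d * (pi2BoundConst d (((2 * R + 2 : ℕ) : ℝ) + ((d / 2 + 1 : ℕ) : ℝ)) *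
        (C * ℓ * κ * A⁻¹)) := by
  set P := abkmNormParams L N Mord R p r₀ h θbar A (schedDelta δ₀ δ₁ N) 𝒞 with hP
  have h8 : 8 ≤ 2 ^ (d + 3) := by
    calc 8 = 2 ^ 3 := by norm_num
      _ ≤ 2 ^ (d + 3) := Nat.pow_le_pow_right (by norm_num) (by omega)
  have hL4 : 4 ≤ L := by omega
  have hL0 : (0 : ℝ) < L := by exact_mod_cast hLodd.pos
  have hpR : p ≤ R := by omega
  -- the torus at scale `k`
  obtain ⟨t, ht⟩ : ∃ t, N = k + t := ⟨N - k, by omega⟩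
  have hMt0 : M = L ^ k * L ^ t := by rw [← pow_add, ← ht]; exact hM
  have hMt : M = P.L ^ k * L ^ t := hMt0
  have htodd : Odd (L ^ t) := hLodd.pow
  -- weights of the two scales
  have h𝔥' : 0 < P.𝔥 (k + 1) := fieldWt_pos hh hL0 d (k + 1)
  have h𝔥k : 0 < P.𝔥 k := fieldWt_pos hh hL0 d k
  have hsucc : P.𝔥 (k + 1) = scaleRatio d L * P.𝔥 k := fieldWt_succ_nat hLodd.pos d k
  have h𝔥le : P.𝔥 (k + 1) ≤ P.𝔥 k := by
    rw [hsucc]; exact mul_le_of_le_one_left h𝔥k.le (scaleRatio_le_one hd hL4)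
  have hR : 0 < P.R k := by show (0 : ℝ) < (L : ℝ) ^ k; positivity
  have hRle : P.R k ≤ P.R (k + 1) := by
    show (L : ℝ) ^ k ≤ (L : ℝ) ^ (k + 1)
    exact pow_le_pow_right₀ (by exact_mod_cast hLodd.pos) (Nat.le_succ k)
  have hr₀' : 2 ≤ P.r₀ := by show 2 ≤ r₀; omega
  -- the box
  obtain ⟨hwrap0, hroom0⟩ := abkm_box_lt (d := d) hL hpR hkN
  have hwrap : 4 * ((P.L ^ k - 1) / 2 + P.rad k) < M := by
    show 4 * ((L ^ k - 1) / 2 + starRad R L d k) < M; rw [hM]; exact hwrap0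
  have hroom : ((2 * ((P.L ^ k - 1) / 2 + P.rad k) : ℕ) + (P.p : ℤ)) * 2 < M := by
    show ((2 * ((L ^ k - 1) / 2 + starRad R L d k) : ℕ) + (p : ℤ)) * 2 < (M : ℤ)
    rw [hM]; exact_mod_cast hroom0
  have hC₀ : (1 : ℝ) ≤ ((2 * R + 2 : ℕ) : ℝ) + ((d / 2 + 1 : ℕ) : ℝ) := by
    have : (1 : ℝ) ≤ ((2 * R + 2 : ℕ) : ℝ) := by exact_mod_cast (show 1 ≤ 2 * R + 2 by omega)
    linarith [(Nat.cast_nonneg (d / 2 + 1) : (0 : ℝ) ≤ _)]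
  have hρ0 : ((2 * ((P.L ^ k - 1) / 2 + P.rad k) : ℕ) : ℝ) + (d / 2 + 1 : ℕ) ≤
      (((2 * R + 2 : ℕ) : ℝ) + ((d / 2 + 1 : ℕ) : ℝ)) * P.R k := abkm_box_C0 (d := d) hL k
  -- `B_k K` only sees `K(B₀)`; replace `K` by its restriction to connected `k`-polymers
  set K' : Finset (Fin d → ZMod M) → ((Fin d → ZMod M) → ℝ) → ℂ :=
    fun X => if IsPolymer (L ^ k) X ∧ IsConn X then K X else 0 with hK'def
  have hMo : Odd M := by rw [hM]; exact hLodd.pow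
  have hPB : IsPolymer (L ^ k) Da.B₀ := by rw [hB₀]; exact isPolymer_blockOf _ x₀
  have hcB : IsConn Da.B₀ := by rw [hB₀]; exact TorusPolymer.isConn_blockOf hMo hLodd.pow x₀
  have hK'B : K' Da.B₀ = K Da.B₀ := by simp only [hK'def, hPB, hcB, and_self, if_true]
  have hopBa : opB Da K = opB Da K' := by unfold opB; rw [hK'B]
  have hopBb : opB Db K = opB Db K' := by unfold opB; rw [hB₀', hK'B]
  have hK' : WeakNormLE P k K' C := fun X hX hc => by
    have : K' X = K X := by
      show (if IsPolymer (L ^ k) X ∧ IsConn X then K X else 0) = K X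
      exact if_pos ⟨hX, hc⟩
    rw [this]; exact hK X hX hc
  have hK'd : ∀ X, ContDiff ℝ P.r₀ (K' X) := fun X => by
    by_cases hX : IsPolymer (L ^ k) X ∧ IsConn X
    · simp only [hK'def, if_pos hX]; exact hKd X
    · simp only [hK'def, if_neg hX]; exact contDiff_const
  have hK'loc : ∀ X, IsPolymer (P.L ^ k) X → IsConn X → IsGaugeLocal (P.gauge k X) (K' X) :=
    fun X hX hc => by
      have : K' X = K X := by
        show (if IsPolymer (L ^ k) X ∧ IsConn X then K X else 0) = K X
        exact if_pos ⟨hX, hc⟩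
      rw [this]; exact hKloc X hX hc
  have hA0 : 0 < A := by linarith
  have h0fl : ∀ 𝒞q : (Fin d → ZMod M) → ℝ, fluct 𝒞q (0 : ((Fin d → ZMod M) → ℝ) → ℂ) = fun _ => 0 := by
    intro 𝒞q; funext φ; unfold fluct; simp
  have hR'a : ∀ X, ContDiff ℝ P.r₀ (fluct Da.𝒞 (K' X)) := fun X => by
    by_cases hX : IsPolymer (L ^ k) X ∧ IsConn X
    · exact contDiff_fluct_of_weakNormLE_of_stepKernelBounds hB hSa hA0 hC hK' hK'd hK'loc hX.1 hX.2
    · have : K' X = 0 := by simp only [hK'def, if_neg hX]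
      rw [this, h0fl]; exact contDiff_const
  have hR'b : ∀ X, ContDiff ℝ P.r₀ (fluct Db.𝒞 (K' X)) := fun X => by
    by_cases hX : IsPolymer (L ^ k) X ∧ IsConn X
    · exact contDiff_fluct_of_weakNormLE_of_stepKernelBounds hB hSb hA0 hC hK' hK'd hK'loc hX.1 hX.2
    · have : K' X = 0 := by simp only [hK'def, if_neg hX]
      rw [this, h0fl]; exact contDiff_const
  -- the abstract estimate for `K'`
  have hmain := hamNorm_opB_sub_le_succ P hMt hLodd htodd Da Db hB₀ hc₀ hB₀' hc₀' h𝔥' h𝔥le hR hRle hr₀'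
    hwrap hroom hC₀ hρ0 (ℓ := ℓ) (κ := κ) hdiff hC hK' hK'd hK'loc hR'a hR'b hA
  -- bookkeeping: `L^d · |B₀| = L^{d(k+1)}`
  have hcard : Da.B₀.card = L ^ (d * k) := by
    rw [hB₀, card_blockOf hMt0 hLodd.pow htodd x₀, ← pow_mul, mul_comm]
  have hn : P.L ^ d * Da.B₀.card = L ^ (d * (k + 1)) := by
    show L ^ d * Da.B₀.card = L ^ (d * (k + 1))
    rw [hcard, ← pow_add]; congr 1; ring
  rw [hopBa, hopBb, ← hn]
  exact hmain

end Literature.MathematicalPhysics.StatisticalMechanics.GradientRG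

end
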